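import Summits.ValiantsHypothesis.ValiantsHypothesis.Theorems.SymPencilPerFourPairingHyperplane
import Mathlib.Algebra.Module.Submodule.Union

/-!
# Route `SymPencil` — tools for the pairing discriminant on SIX-dimensional two-row spaces
# (towards leaf 5 `stub_twoLineFilter` of `Cruxes/SdcSuperquadratic/Lines/sing_six_classification.lean`;
# `--supports` stmt-ValiantsHypothesis-5674 `SdcSuperquadratic`; rung currency only, nothing here
# bears on `VP ≠ VNP`)

Coordinates on `K⁸ = K^{Fin 4 ⊕ Fin 4}`: `α_i = Y (inl i)`, `β_i = Y (inr i)`; the PAIRING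
DISCRIMINANT is `A·B - 4Π`, `A = Σ_j α_j Π_{i≠j} β_i`, `B = Σ_j β_j Π_{i≠j} α_i`, `Π = Π_i α_i β_i`
(`SymPencilPerFourRowPairing`, `SymPencilPerFourPairingHyperplane`; it vanishes on the two rows of
every `y` with `rank Hess per_4 (y) ≤ 7`).  This file collects the algebra used by the
six-dimensional classification (`SymPencilPerFourPairingDiscSix*`):

* `sumA_four` / `sumB_four` / `prodAB_four`: the closed forms of `A`, `B`, `Π`;
* `linePoly_*`: functions polynomial along lines are closed under the ring operations, so the
  discriminant is polynomial along every line (`linePoly_disc`), and a polynomial function vanishing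
  off `t = 0` vanishes at `t = 0` (`eval_zero_of_forall_ne_zero`);
* `two_zeros_of_disc_vanish`: if `A·B = 4Π` for ALL `α ∈ K⁴` then `β` has two zero coordinates
  (specialise `α` to `x e_j + Σ_{i∉{j,k}} e_i` and read off `β_k Π_{i≠j} β_i = 0`);
* `exists_pair_of_forall_two_zeros` / `single_mem_of_le_pair`: a subspace all of whose vectors have
  two zero coordinates lies in one coordinate plane (a vector space over an infinite field is not a
  finite union of proper subspaces, `Submodule.exists_forall_notMem_of_forall_ne_top`), and a
  `2`-dimensional one IS that plane.

Honest framing: lemmas; `27 ≤ sdc(per₄) ≤ 29` unchanged, stmt-5674 open, `VP ≠ VNP` not moved, no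
summit statement is proved here.  No definitions, no named facts. [folklore]
-/

noncomputable section

-- single-conjunct layout: Sub = Summit, duplicated namespace component intended
set_option linter.dupNamespace false

namespace Summit.ValiantsHypothesis.ValiantsHypothesis.Theorems.SymPencilPerFourPairingDiscTools

open Matrix Finset Module Polynomial
open Summit.ValiantsHypothesis.ValiantsHypothesis.Theorems.SymPencilPerFourPairingHyperplane

variable {K : Type*} [Field K]

/-! ### Closed forms -/

/-- `A = Σ_j α_j Π_{i≠j} β_i` on `Fin 4`. [folklore] -/
theorem sumA_four (α β : Fin 4 → K) :
    (∑ j, ∏ i, if i = j then α i else β i) =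
      α 0 * β 1 * β 2 * β 3 + β 0 * α 1 * β 2 * β 3 + β 0 * β 1 * α 2 * β 3 +
        β 0 * β 1 * β 2 * α 3 := by
  simp only [Fin.sum_univ_four, Fin.prod_univ_four]
  simp

/-- `Π = Π_i α_i β_i` on `Fin 4`. [folklore] -/
theorem prodAB_four (α β : Fin 4 → K) :
    ∏ i, α i * β i = α 0 * β 0 * (α 1 * β 1) * (α 2 * β 2) * (α 3 * β 3) := by
  rw [Fin.prod_univ_four]

/-! ### Functions polynomial along lines -/

section LinePoly

variable {M : Type*} [AddCommGroup M] [Module K M]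

/-- Constants are polynomial along lines. [folklore] -/
theorem linePoly_const (c : K) (y₀ y : M) :
    ∃ p : K[X], ∀ t : K, (fun _ : M => c) (y₀ + t • y) = p.eval t :=
  ⟨Polynomial.C c, fun t => by simp⟩

/-- Linear functionals are polynomial along lines. [folklore] -/
theorem linePoly_linear (g : M →ₗ[K] K) (y₀ y : M) :
    ∃ p : K[X], ∀ t : K, g (y₀ + t • y) = p.eval t :=
  ⟨Polynomial.C (g y₀) + Polynomial.C (g y) * Polynomial.X, fun t => by
    simp only [map_add, map_smul, smul_eq_mul, eval_add, eval_mul, eval_C, eval_X]; ring⟩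

/-- Products of functions polynomial along lines are polynomial along lines. [folklore] -/
theorem linePoly_mul {f g : M → K}
    (hf : ∀ y₀ y : M, ∃ p : K[X], ∀ t : K, f (y₀ + t • y) = p.eval t)
    (hg : ∀ y₀ y : M, ∃ p : K[X], ∀ t : K, g (y₀ + t • y) = p.eval t) :
    ∀ y₀ y : M, ∃ p : K[X], ∀ t : K, (fun z => f z * g z) (y₀ + t • y) = p.eval t := by
  intro y₀ y
  obtain ⟨p, hp⟩ := hf y₀ y
  obtain ⟨q, hq⟩ := hg y₀ y
  exact ⟨p * q, fun t => by rw [eval_mul, ← hp t, ← hq t]⟩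

/-- Sums of functions polynomial along lines are polynomial along lines. [folklore] -/
theorem linePoly_add {f g : M → K}
    (hf : ∀ y₀ y : M, ∃ p : K[X], ∀ t : K, f (y₀ + t • y) = p.eval t)
    (hg : ∀ y₀ y : M, ∃ p : K[X], ∀ t : K, g (y₀ + t • y) = p.eval t) :
    ∀ y₀ y : M, ∃ p : K[X], ∀ t : K, (fun z => f z + g z) (y₀ + t • y) = p.eval t := by
  intro y₀ y
  obtain ⟨p, hp⟩ := hf y₀ y
  obtain ⟨q, hq⟩ := hg y₀ y
  exact ⟨p + q, fun t => by rw [eval_add, ← hp t, ← hq t]⟩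

/-- Differences of functions polynomial along lines are polynomial along lines. [folklore] -/
theorem linePoly_sub {f g : M → K}
    (hf : ∀ y₀ y : M, ∃ p : K[X], ∀ t : K, f (y₀ + t • y) = p.eval t)
    (hg : ∀ y₀ y : M, ∃ p : K[X], ∀ t : K, g (y₀ + t • y) = p.eval t) :
    ∀ y₀ y : M, ∃ p : K[X], ∀ t : K, (fun z => f z - g z) (y₀ + t • y) = p.eval t := by
  intro y₀ y
  obtain ⟨p, hp⟩ := hf y₀ y
  obtain ⟨q, hq⟩ := hg y₀ y
  exact ⟨p - q, fun t => by rw [eval_sub, ← hp t, ← hq t]⟩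

/-- Finite products of functions polynomial along lines are polynomial along lines. [folklore] -/
theorem linePoly_prod {ι : Type*} (s : Finset ι) {f : ι → M → K}
    (hf : ∀ i ∈ s, ∀ y₀ y : M, ∃ p : K[X], ∀ t : K, f i (y₀ + t • y) = p.eval t) :
    ∀ y₀ y : M, ∃ p : K[X], ∀ t : K, (fun z => ∏ i ∈ s, f i z) (y₀ + t • y) = p.eval t := by
  classical
  induction s using Finset.induction_on with
  | empty => exact fun y₀ y => ⟨1, fun t => by simp⟩
  | @insert a s ha ih =>
    intro y₀ y
    obtain ⟨p, hp⟩ := hf a (Finset.mem_insert_self a s) y₀ y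
    obtain ⟨q, hq⟩ := ih (fun i hi => hf i (Finset.mem_insert_of_mem hi)) y₀ y
    refine ⟨p * q, fun t => ?_⟩
    simp only [Finset.prod_insert ha] at hq ⊢
    rw [eval_mul, ← hp t, ← hq t]

/-- Finite sums of functions polynomial along lines are polynomial along lines. [folklore] -/
theorem linePoly_sum {ι : Type*} (s : Finset ι) {f : ι → M → K}
    (hf : ∀ i ∈ s, ∀ y₀ y : M, ∃ p : K[X], ∀ t : K, f i (y₀ + t • y) = p.eval t) :
    ∀ y₀ y : M, ∃ p : K[X], ∀ t : K, (fun z => ∑ i ∈ s, f i z) (y₀ + t • y) = p.eval t := by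
  classical
  induction s using Finset.induction_on with
  | empty => exact fun y₀ y => ⟨0, fun t => by simp⟩
  | @insert a s ha ih =>
    intro y₀ y
    obtain ⟨p, hp⟩ := hf a (Finset.mem_insert_self a s) y₀ y
    obtain ⟨q, hq⟩ := ih (fun i hi => hf i (Finset.mem_insert_of_mem hi)) y₀ y
    refine ⟨p + q, fun t => ?_⟩
    simp only [Finset.sum_insert ha] at hq ⊢
    rw [eval_add, ← hp t, ← hq t]

/-- **A function polynomial along lines which vanishes off `t = 0` on a line vanishes at `t = 0`**
(infinite field). [folklore] -/
theorem eval_zero_of_forall_ne_zero [Infinite K] {f : M → K} {y₀ y : M}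
    (hf : ∃ p : K[X], ∀ t : K, f (y₀ + t • y) = p.eval t)
    (h : ∀ t : K, t ≠ 0 → f (y₀ + t • y) = 0) : f y₀ = 0 := by
  obtain ⟨p, hp⟩ := hf
  have hp0 : p = 0 := by
    by_contra hne
    have hfin : {x : K | p.IsRoot x}.Finite := Polynomial.finite_setOf_isRoot hne
    have hsub : {x : K | x ≠ 0} ⊆ {x : K | p.IsRoot x} := fun x hx => by
      simp only [Set.mem_setOf_eq, Polynomial.IsRoot.def, ← hp x]
      exact h x hx
    have hinf : ({x : K | x ≠ 0} : Set K).Infinite := by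
      have : ({x : K | x ≠ 0} : Set K) = Set.univ \ {0} := by
        ext x; simp
      rw [this]
      exact Set.infinite_univ.sdiff (Set.finite_singleton 0)
    exact hinf (hfin.subset hsub)
  have h0 := hp 0
  rw [zero_smul, add_zero, hp0, eval_zero] at h0
  exact h0

end LinePoly

/-- **The pairing discriminant is polynomial along lines** in `K⁸`. [folklore] -/
theorem linePoly_disc (Y₀ Y : Fin 4 ⊕ Fin 4 → K) :
    ∃ p : K[X], ∀ t : K,
      (fun Z : Fin 4 ⊕ Fin 4 → K =>
        (∑ j, ∏ i, if i = j then Z (Sum.inl i) else Z (Sum.inr i)) *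
          (∑ j, ∏ i, if i = j then Z (Sum.inr i) else Z (Sum.inl i)) -
          4 * ∏ i, Z (Sum.inl i) * Z (Sum.inr i)) (Y₀ + t • Y) = p.eval t := by
  have hc : ∀ c : Fin 4 ⊕ Fin 4, ∀ y₀ y : Fin 4 ⊕ Fin 4 → K, ∃ p : K[X], ∀ t : K,
      (fun Z : Fin 4 ⊕ Fin 4 → K => Z c) (y₀ + t • y) = p.eval t :=
    fun c y₀ y => linePoly_linear (LinearMap.proj c : (Fin 4 ⊕ Fin 4 → K) →ₗ[K] K) y₀ y
  have hif : ∀ (P : Prop) [Decidable P] (c c' : Fin 4 ⊕ Fin 4), ∀ y₀ y : Fin 4 ⊕ Fin 4 → K,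
      ∃ p : K[X], ∀ t : K,
        (fun Z : Fin 4 ⊕ Fin 4 → K => if P then Z c else Z c') (y₀ + t • y) = p.eval t := by
    intro P _ c c' y₀ y
    by_cases hP : P
    · simpa [hP] using hc c y₀ y
    · simpa [hP] using hc c' y₀ y
  have hA : ∀ y₀ y : Fin 4 ⊕ Fin 4 → K, ∃ p : K[X], ∀ t : K,
      (fun Z : Fin 4 ⊕ Fin 4 → K => ∑ j, ∏ i, if i = j then Z (Sum.inl i) else Z (Sum.inr i))
        (y₀ + t • y) = p.eval t :=
    linePoly_sum (M := Fin 4 ⊕ Fin 4 → K) (Finset.univ : Finset (Fin 4))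
      (f := fun j Z => ∏ i, if i = j then Z (Sum.inl i) else Z (Sum.inr i))
      (fun j _ => linePoly_prod (M := Fin 4 ⊕ Fin 4 → K) (Finset.univ : Finset (Fin 4))
        (f := fun i Z => if i = j then Z (Sum.inl i) else Z (Sum.inr i))
        (fun i _ => hif (i = j) (Sum.inl i) (Sum.inr i)))
  have hB : ∀ y₀ y : Fin 4 ⊕ Fin 4 → K, ∃ p : K[X], ∀ t : K,
      (fun Z : Fin 4 ⊕ Fin 4 → K => ∑ j, ∏ i, if i = j then Z (Sum.inr i) else Z (Sum.inl i))
        (y₀ + t • y) = p.eval t :=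
    linePoly_sum (M := Fin 4 ⊕ Fin 4 → K) (Finset.univ : Finset (Fin 4))
      (f := fun j Z => ∏ i, if i = j then Z (Sum.inr i) else Z (Sum.inl i))
      (fun j _ => linePoly_prod (M := Fin 4 ⊕ Fin 4 → K) (Finset.univ : Finset (Fin 4))
        (f := fun i Z => if i = j then Z (Sum.inr i) else Z (Sum.inl i))
        (fun i _ => hif (i = j) (Sum.inr i) (Sum.inl i)))
  have hP : ∀ y₀ y : Fin 4 ⊕ Fin 4 → K, ∃ p : K[X], ∀ t : K,
      (fun Z : Fin 4 ⊕ Fin 4 → K => ∏ i, Z (Sum.inl i) * Z (Sum.inr i)) (y₀ + t • y) = p.eval t :=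
    linePoly_prod (M := Fin 4 ⊕ Fin 4 → K) (Finset.univ : Finset (Fin 4))
      (f := fun i Z => Z (Sum.inl i) * Z (Sum.inr i))
      (fun i _ => linePoly_mul (f := fun Z : Fin 4 ⊕ Fin 4 → K => Z (Sum.inl i))
        (g := fun Z : Fin 4 ⊕ Fin 4 → K => Z (Sum.inr i)) (hc (Sum.inl i)) (hc (Sum.inr i)))
  have h4 := linePoly_mul (f := fun _ : Fin 4 ⊕ Fin 4 → K => (4 : K))
    (g := fun Z : Fin 4 ⊕ Fin 4 → K => ∏ i, Z (Sum.inl i) * Z (Sum.inr i))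
    (linePoly_const (M := Fin 4 ⊕ Fin 4 → K) (4 : K)) hP
  exact linePoly_sub
    (f := fun Z : Fin 4 ⊕ Fin 4 → K =>
      (∑ j, ∏ i, if i = j then Z (Sum.inl i) else Z (Sum.inr i)) *
        (∑ j, ∏ i, if i = j then Z (Sum.inr i) else Z (Sum.inl i)))
    (g := fun Z : Fin 4 ⊕ Fin 4 → K => 4 * ∏ i, Z (Sum.inl i) * Z (Sum.inr i))
    (linePoly_mul
      (f := fun Z : Fin 4 ⊕ Fin 4 → K => ∑ j, ∏ i, if i = j then Z (Sum.inl i) else Z (Sum.inr i))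
      (g := fun Z : Fin 4 ⊕ Fin 4 → K => ∑ j, ∏ i, if i = j then Z (Sum.inr i) else Z (Sum.inl i))
      hA hB) h4 Y₀ Y

/-! ### `A·B = 4Π` for all `α` forces two zero coordinates of `β` -/

/-- **If `A·B = 4Π` for every `α ∈ K⁴`, then `β` has two zero coordinates** (characteristic
`0`). [folklore] -/
theorem two_zeros_of_disc_vanish [CharZero K] (b : Fin 4 → K)
    (h : ∀ α : Fin 4 → K,
      (∑ j, ∏ i, if i = j then α i else b i) * (∑ j, ∏ i, if i = j then b i else α i) =
        4 * ∏ i, α i * b i) :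
    ∃ m m' : Fin 4, m ≠ m' ∧ b m = 0 ∧ b m' = 0 := by
  -- `b_k Π_{i ≠ j} b_i = 0` for `(j,k) ∈ {(0,1), (1,0), (2,0), (3,0)}`
  have e01 : b 1 * b 1 * b 2 * b 3 = 0 := by
    have h1 := h ![1, 0, 1, 1]
    have h2 := h ![2, 0, 1, 1]
    simp only [sumA_four, prodAB_four, Fin.isValue, Matrix.cons_val_zero, Matrix.cons_val_one,
      Matrix.cons_val, one_mul, mul_one, mul_zero, zero_mul, add_zero, zero_add] at h1 h2
    linear_combination h2 / 2 - h1
  have e10 : b 0 * b 0 * b 2 * b 3 = 0 := by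
    have h1 := h ![0, 1, 1, 1]
    have h2 := h ![0, 2, 1, 1]
    simp only [sumA_four, prodAB_four, Fin.isValue, Matrix.cons_val_zero, Matrix.cons_val_one,
      Matrix.cons_val, one_mul, mul_one, mul_zero, zero_mul, add_zero, zero_add] at h1 h2
    linear_combination h2 / 2 - h1
  have e20 : b 0 * b 0 * b 1 * b 3 = 0 := by
    have h1 := h ![0, 1, 1, 1]
    have h2 := h ![0, 1, 2, 1]
    simp only [sumA_four, prodAB_four, Fin.isValue, Matrix.cons_val_zero, Matrix.cons_val_one,
      Matrix.cons_val, one_mul, mul_one, mul_zero, zero_mul, add_zero, zero_add] at h1 h2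
    linear_combination h2 / 2 - h1
  have e30 : b 0 * b 0 * b 1 * b 2 = 0 := by
    have h1 := h ![0, 1, 1, 1]
    have h2 := h ![0, 1, 1, 2]
    simp only [sumA_four, prodAB_four, Fin.isValue, Matrix.cons_val_zero, Matrix.cons_val_one,
      Matrix.cons_val, one_mul, mul_one, mul_zero, zero_mul, add_zero, zero_add] at h1 h2
    linear_combination h2 / 2 - h1
  by_cases hb0 : b 0 = 0
  · rcases mul_eq_zero.1 e01 with h' | h3
    · rcases mul_eq_zero.1 h' with h'' | h2
      · have h1 : b 1 = 0 := by simpa using mul_eq_zero.1 h''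
        exact ⟨0, 1, by decide, hb0, h1⟩
      · exact ⟨0, 2, by decide, hb0, h2⟩
    · exact ⟨0, 3, by decide, hb0, h3⟩
  · have hb00 : b 0 * b 0 ≠ 0 := mul_ne_zero hb0 hb0
    rcases mul_eq_zero.1 e10 with h' | h3
    · rcases mul_eq_zero.1 h' with h'' | h2
      · exact absurd h'' hb00
      · -- `b 2 = 0`; second zero from `e20`
        rcases mul_eq_zero.1 e20 with h4 | h3
        · rcases mul_eq_zero.1 h4 with h5 | h1
          · exact absurd h5 hb00
          · exact ⟨1, 2, by decide, h1, h2⟩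
        · exact ⟨2, 3, by decide, h2, h3⟩
    · -- `b 3 = 0`; second zero from `e30`
      rcases mul_eq_zero.1 e30 with h4 | h2
      · rcases mul_eq_zero.1 h4 with h5 | h1
        · exact absurd h5 hb00
        · exact ⟨1, 3, by decide, h1, h3⟩
      · exact ⟨2, 3, by decide, h2, h3⟩

/-! ### Subspaces all of whose vectors have two zero coordinates -/

/-- **A subspace of `K⁴` all of whose vectors have two zero coordinates lies in one coordinate
plane** (infinite field). [folklore] -/
theorem exists_pair_of_forall_two_zeros [Infinite K] (B₀ : Submodule K (Fin 4 → K))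
    (hz : ∀ b ∈ B₀, ∃ m m' : Fin 4, m ≠ m' ∧ b m = 0 ∧ b m' = 0) :
    ∃ m m' : Fin 4, m ≠ m' ∧ ∀ b ∈ B₀, b m = 0 ∧ b m' = 0 := by
  classical
  let ι := {x : Fin 4 × Fin 4 // x.1 ≠ x.2}
  let p : ι → Submodule K B₀ := fun x =>
    (LinearMap.ker (LinearMap.proj x.1.1 : (Fin 4 → K) →ₗ[K] K) ⊓
      LinearMap.ker (LinearMap.proj x.1.2 : (Fin 4 → K) →ₗ[K] K)).comap B₀.subtype
  have memp : ∀ (x : ι) (v : B₀), v ∈ p x ↔ (v : Fin 4 → K) x.1.1 = 0 ∧ (v : Fin 4 → K) x.1.2 = 0 :=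
    fun x v => by
      simp only [p, Submodule.mem_comap, Submodule.mem_inf, LinearMap.mem_ker,
        Submodule.coe_subtype, LinearMap.coe_proj, Function.eval]
  by_cases hall : ∀ x : ι, p x ≠ ⊤
  · obtain ⟨v, hv⟩ := Submodule.exists_forall_notMem_of_forall_ne_top p hall
    obtain ⟨m, m', hmm, h1, h2⟩ := hz v v.2
    exact absurd ((memp ⟨(m, m'), hmm⟩ v).2 ⟨h1, h2⟩) (hv ⟨(m, m'), hmm⟩)
  · push Not at hall
    obtain ⟨x, hx⟩ := hall
    refine ⟨x.1.1, x.1.2, x.2, fun b hb => ?_⟩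
    have hmem : (⟨b, hb⟩ : B₀) ∈ p x := by rw [hx]; exact Submodule.mem_top
    exact (memp x ⟨b, hb⟩).1 hmem

/-- **A `2`-dimensional subspace inside a coordinate plane IS the plane**: it contains the two
remaining unit vectors. [folklore] -/
theorem single_mem_of_le_pair (B₀ : Submodule K (Fin 4 → K)) (h2 : finrank K B₀ = 2)
    {m m' : Fin 4} (hmm : m ≠ m') (hle : ∀ b ∈ B₀, b m = 0 ∧ b m' = 0)
    (n : Fin 4) (hn : n ≠ m) (hn' : n ≠ m') : (Pi.single n 1 : Fin 4 → K) ∈ B₀ := by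
  classical
  -- the coordinate plane as the kernel of `b ↦ (b m, b m')`
  let ψ : (Fin 4 → K) →ₗ[K] (Fin 2 → K) :=
    LinearMap.pi fun i => LinearMap.proj (![m, m'] i)
  have hψ : ∀ b i, ψ b i = b (![m, m'] i) := fun _ _ => rfl
  have hsurj : Function.Surjective ψ := by
    intro c
    refine ⟨Pi.single m (c 0) + Pi.single m' (c 1), ?_⟩
    funext i
    fin_cases i
    · simp [hψ, hmm]
    · simp [hψ, hmm.symm]
  have hker : finrank K (LinearMap.ker ψ) = 2 := by
    have h := LinearMap.finrank_range_add_finrank_ker ψ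
    rw [LinearMap.range_eq_top.2 hsurj, finrank_top, Module.finrank_fintype_fun_eq_card,
      Fintype.card_fin, Module.finrank_fintype_fun_eq_card, Fintype.card_fin] at h
    omega
  have hle' : B₀ ≤ LinearMap.ker ψ := by
    intro b hb
    rw [LinearMap.mem_ker]
    funext i
    fin_cases i
    · simpa [hψ] using (hle b hb).1
    · simpa [hψ] using (hle b hb).2
  have heq : B₀ = LinearMap.ker ψ :=
    Submodule.eq_of_le_of_finrank_le hle' (by rw [hker, h2])
  rw [heq, LinearMap.mem_ker]
  funext i
  fin_cases i
  · simp [hψ, hn.symm]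
  · simp [hψ, hn'.symm]

end Summit.ValiantsHypothesis.ValiantsHypothesis.Theorems.SymPencilPerFourPairingDiscTools

end
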